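import Summits.RiemannHypothesis.RiemannHypothesis.Theorems.OddSectorOddOneSignedWindowsFirstBadHeight
import HarnessLib

/-!
# All windows good, or a first bad height — the crux-free form of the dichotomy
# (helper for crux `OddSector.OddOneSignedWindows`, item stmt-RiemannHypothesis-17778; RH-free)

Companion of `Theorems/OddSectorOddOneSignedWindowsFirstBadHeight.lean`
(`oddOneSignedWindows_or_exists_firstBadHeight`: the crux, or a first bad height). Here the
dichotomy is stated WITHOUT the crux: either EVERY window `a > 0` carries a one-signed real odd-sector
ground state, or there is a first bad height `b ≥ ½ log 2` — all windows in `(0, b]` are good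
(`b` itself by sequential closedness, `goodWindows_seqClosed`) and bad windows accumulate at `b` from
the right. Inputs (RH-free, in the tree): small windows are good
(`exists_isWeilOddGroundState_oneSigned_of_two_mul_le_log_two`) and the good set is sequentially
closed in `(0, ∞)`. (Separate file because the whole-file append to `…FirstBadHeight.lean`,
proposals p154266/p157242/p159505, has been pending unverified at the gate since 10:21Z.)
-/

noncomputable section

set_option linter.dupNamespace false

open MeasureTheory Set Filter
open scoped Topology

namespace Summit.RiemannHypothesis.RiemannHypothesis.Theorems.OddSector

open Literature.NumberTheory.LFunctions

/-- **All windows good, or a first bad height (crux-independent form of the dichotomy; registered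
sub-goal `allGoodWindows_or_exists_firstBadHeight` of item stmt-RiemannHypothesis-17778; RH-free).**
Either EVERY window `a > 0` carries a one-signed real odd-sector ground state, or there is a height
`b ≥ ½ log 2` below which all windows are good (including `b`, by closedness) and at which bad
windows accumulate from the right. (The non-certified numerics of the origin cusp, evidence
`OddOneSignedWindows-finestructure.md` on the item, put the second alternative at `b ≤ log 2`: the
window `log 2` is bad, with a hole of width `≈ 2·10⁻⁷` around it.) [folklore] -/
theorem allGoodWindows_or_exists_firstBadHeight :
    (∀ a : ℝ, 0 < a → ∃ u : ℝ → ℂ, IsWeilOddGroundState a u ∧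
        ∀ᵐ t : ℝ, t ∈ Ioo 0 a → (u t).im = 0 ∧ 0 ≤ (u t).re) ∨
      ∃ b : ℝ, Real.log 2 / 2 ≤ b ∧
        (∀ a : ℝ, 0 < a → a ≤ b → ∃ u : ℝ → ℂ, IsWeilOddGroundState a u ∧
          ∀ᵐ t : ℝ, t ∈ Ioo 0 a → (u t).im = 0 ∧ 0 ≤ (u t).re) ∧
        ∀ δ : ℝ, 0 < δ → ∃ a : ℝ, b < a ∧ a < b + δ ∧ ¬ ∃ u : ℝ → ℂ, IsWeilOddGroundState a u ∧
          ∀ᵐ t : ℝ, t ∈ Ioo 0 a → (u t).im = 0 ∧ 0 ≤ (u t).re := by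
  classical
  set good : ℝ → Prop := fun a ↦ ∃ u : ℝ → ℂ, IsWeilOddGroundState a u ∧
    ∀ᵐ t : ℝ, t ∈ Ioo 0 a → (u t).im = 0 ∧ 0 ≤ (u t).re with hgood_def
  by_cases hall : ∀ a : ℝ, 0 < a → good a
  · exact Or.inl hall
  right
  push Not at hall
  obtain ⟨A, hApos, hA⟩ := hall
  have hsmall : ∀ a : ℝ, 0 < a → 2 * a ≤ Real.log 2 → good a := fun a ha h2 ↦
    exists_isWeilOddGroundState_oneSigned_of_two_mul_le_log_two ha h2
  have hlog2 : 0 < Real.log 2 := Real.log_pos (by norm_num)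
  set S : Set ℝ := {c : ℝ | ∀ a : ℝ, 0 < a → a ≤ c → good a} with hS_def
  have hmemS : Real.log 2 / 2 ∈ S := fun a ha hac ↦ hsmall a ha (by linarith)
  have hSne : S.Nonempty := ⟨_, hmemS⟩
  have hSbdd : BddAbove S := by
    refine ⟨A, fun c hc ↦ ?_⟩
    by_contra hlt
    push Not at hlt
    exact hA (hc A hApos hlt.le)
  set b : ℝ := sSup S with hb_def
  have hb_ge : Real.log 2 / 2 ≤ b := le_csSup hSbdd hmemS
  have hb_pos : 0 < b := lt_of_lt_of_le (by positivity) hb_ge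
  have hbelow : ∀ a : ℝ, 0 < a → a < b → good a := by
    intro a ha hab
    obtain ⟨c, hcS, hac⟩ := exists_lt_of_lt_csSup hSne hab
    exact hcS a ha hac.le
  have hb_good : good b := by
    have hseq : ∀ n : ℕ, good (b * (1 - 1 / ((n : ℝ) + 2))) := by
      intro n
      have hn : (0 : ℝ) < (n : ℝ) + 2 := by positivity
      have h1 : 0 < 1 - 1 / ((n : ℝ) + 2) := by
        rw [sub_pos, div_lt_one hn]; linarith
      have h2 : 1 - 1 / ((n : ℝ) + 2) < 1 := by
        have : 0 < 1 / ((n : ℝ) + 2) := by positivity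
        linarith
      exact hbelow _ (mul_pos hb_pos h1) (by nlinarith)
    have htend : Tendsto (fun n : ℕ ↦ b * (1 - 1 / ((n : ℝ) + 2))) atTop (𝓝 b) := by
      have h0 : Tendsto (fun n : ℕ ↦ 1 / ((n : ℝ) + 2)) atTop (𝓝 0) := by
        have := tendsto_one_div_add_atTop_nhds_zero_nat (𝕜 := ℝ)
        refine (this.comp (tendsto_add_atTop_nat 1)).congr fun n ↦ ?_
        simp only [Function.comp_apply, Nat.cast_add, Nat.cast_one]
        ring
      have : Tendsto (fun n : ℕ ↦ b * (1 - 1 / ((n : ℝ) + 2))) atTop (𝓝 (b * (1 - 0))) :=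
        (h0.const_sub 1).const_mul b
      simpa using this
    exact goodWindows_seqClosed b _ hb_pos htend hseq
  refine ⟨b, hb_ge, fun a ha hab ↦ ?_, fun δ hδ ↦ ?_⟩
  · rcases hab.lt_or_eq with hlt | heq
    · exact hbelow a ha hlt
    · rw [heq]; exact hb_good
  · by_contra hnone
    push Not at hnone
    have hmem : b + δ / 2 ∈ S := by
      intro a ha hale
      rcases le_or_gt a b with hab | hba
      · rcases hab.lt_or_eq with hlt | heq
        · exact hbelow a ha hlt
        · rw [heq]; exact hb_good
      · exact hnone a hba (by linarith)
    have : b + δ / 2 ≤ b := le_csSup hSbdd hmem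
    linarith

end Summit.RiemannHypothesis.RiemannHypothesis.Theorems.OddSector

end
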